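import Mathlib
import Summits.KontsevichZagierPeriods.Zeta5Search.Certificates.RecordRayApery
import HarnessLib

/-!
# Clause (E) for the literal pair `(P_n, Q_n)` (fam-tele g15, S4-R1 file 3c)

HONEST FRAMING: systematic search; no irrationality claim unless certified.  `RecordRayApery.aperyType_record`
gives the Apéry-type recursion for `(p̂_n, q̂_n) = (P_n, Q_n)/ρ_n`.  Here the unit `ρ_n = rhoOf (aRec n)` is put back:
`ρ_n` is a quotient of factorials of multiples of `n` (`rhoOf_aRec_eq`, positive — the sign `(−1)^{Σ b_j} = (−1)^{98n}`
is `+1`), so `ρ_{n+1}·D(n) = ρ_n·N(n)` with explicit `N, D ∈ ℚ[n]` (`rho_succ`), and multiplying the coefficients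
`cPoly k` by the appropriate shifts of `N, D` gives ONE order-3 recurrence with coefficients in `ℚ[n]` and nonzero top
coefficient for Brown–Zudilin's own `P_n = recordP n` and `Q_n = recordQ n`:
`aperyType_recordPQ : IsAperyType recordP (fun n => (recordQ n : ℚ))`.  An algebraic statement; nothing about `ζ(5)`.
-/

namespace Summit.KontsevichZagierPeriods.Zeta5Search.RecordRay.Generic

open Finset Matrix Filter Polynomial
open Summit.KontsevichZagierPeriods.Zeta5Search.WedgeDictionary (rhoOf dOf Epairs)
open Summit.KontsevichZagierPeriods.Zeta5Search.DualSeriesLemma19 (bRecord)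
open Summit.KontsevichZagierPeriods.Zeta5Search.RecordRay (aRec recordP recordQ bOfA_aRec bRecord_zero bRecord_slot
  dOf_aRec)
open Literature.NumberTheory.Irrationality.BrownZudilin2022 (IsAperyType bOfA)

/-! ### 1. `ρ(a·n)` in factorials -/

/-- The numerator of `ρ(a·n)`: `∏_{(j,k)∈E} ((5+j+k)·n)!`. -/
def Fnum (n : ℕ) : ℚ :=
  (((8 * n).factorial : ℕ) : ℚ) * (((9 * n).factorial : ℕ) : ℚ) * (((10 * n).factorial : ℕ) : ℚ) *
    (((11 * n).factorial : ℕ) : ℚ) * (((10 * n).factorial : ℕ) : ℚ) * (((11 * n).factorial : ℕ) : ℚ) *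
    (((12 * n).factorial : ℕ) : ℚ) * (((13 * n).factorial : ℕ) : ℚ) * (((12 * n).factorial : ℕ) : ℚ) *
    (((14 * n).factorial : ℕ) : ℚ) * (((15 * n).factorial : ℕ) : ℚ) * (((16 * n).factorial : ℕ) : ℚ) *
    (((16 * n).factorial : ℕ) : ℚ) * (((17 * n).factorial : ℕ) : ℚ) * (((18 * n).factorial : ℕ) : ℚ)

/-- The denominator of `ρ(a·n)`: `4 · (17n)! (14n)! (13n)! (12n)! (11n)! · (25n)!`. -/
def Gden (n : ℕ) : ℚ :=
  4 * ((((17 * n).factorial : ℕ) : ℚ) * (((14 * n).factorial : ℕ) : ℚ) * (((13 * n).factorial : ℕ) : ℚ) *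
    (((12 * n).factorial : ℕ) : ℚ) * (((11 * n).factorial : ℕ) : ℚ)) * (((25 * n).factorial : ℕ) : ℚ)

/-- The denominator of `ρ(a·n)` is positive. -/
theorem Gden_pos (n : ℕ) : 0 < Gden n := by unfold Gden; positivity

/-- **`ρ(a·n)` in factorials** (cf. `RecordRayStirling.abs_rhoOf_aRec` for `|ρ|`; here with the sign: it is `+1`). -/
theorem rhoOf_aRec_eq (n : ℕ) : rhoOf (aRec n) = Fnum n / Gden n := by
  unfold Fnum Gden
  have hb0 : bOfA (aRec n) 0 = 41 * n := by rw [bOfA_aRec, bRecord_zero]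
  have hbj : ∀ j : ℕ, 1 ≤ j → j ≤ 7 → bOfA (aRec n) j = ((18 - j : ℕ) : ℤ) * n := fun j h1 h7 => by
    rw [bOfA_aRec, bRecord_slot n h1 h7]
  have h1 := hbj 1 (by norm_num) (by norm_num)
  have h2 := hbj 2 (by norm_num) (by norm_num)
  have h3 := hbj 3 (by norm_num) (by norm_num)
  have h4 := hbj 4 (by norm_num) (by norm_num)
  have h5 := hbj 5 (by norm_num) (by norm_num)
  have h6 := hbj 6 (by norm_num) (by norm_num)
  have h7 := hbj 7 (by norm_num) (by norm_num)
  norm_num at h1 h2 h3 h4 h5 h6 h7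
  have hd := dOf_aRec n
  have hs : (∑ j ∈ range 7, bOfA (aRec n) (j + 1)).toNat = 2 * (49 * n) := by
    simp only [sum_range_succ, sum_range_zero, zero_add, Nat.reduceAdd, h1, h2, h3, h4, h5, h6, h7]
    rw [show (17 : ℤ) * n + 16 * n + 15 * n + 14 * n + 13 * n + 12 * n + 11 * n = ((2 * (49 * n) : ℕ) : ℤ) by
      push_cast; ring, Int.toNat_natCast]
  unfold rhoOf
  simp only [Epairs, List.map_cons, List.map_nil, List.prod_cons, List.prod_nil, hs, pow_mul, neg_one_sq, one_pow,
    one_mul, hb0, h1, h2, h3, h4, h5, h6, h7, hd]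
  rw [show (41 : ℤ) * n - 17 * n - 16 * n = ((8 * n : ℕ) : ℤ) by push_cast; ring,
    show (41 : ℤ) * n - 17 * n - 15 * n = ((9 * n : ℕ) : ℤ) by push_cast; ring,
    show (41 : ℤ) * n - 17 * n - 14 * n = ((10 * n : ℕ) : ℤ) by push_cast; ring,
    show (41 : ℤ) * n - 17 * n - 13 * n = ((11 * n : ℕ) : ℤ) by push_cast; ring,
    show (41 : ℤ) * n - 16 * n - 15 * n = ((10 * n : ℕ) : ℤ) by push_cast; ring,
    show (41 : ℤ) * n - 16 * n - 14 * n = ((11 * n : ℕ) : ℤ) by push_cast; ring,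
    show (41 : ℤ) * n - 16 * n - 13 * n = ((12 * n : ℕ) : ℤ) by push_cast; ring,
    show (41 : ℤ) * n - 16 * n - 12 * n = ((13 * n : ℕ) : ℤ) by push_cast; ring,
    show (41 : ℤ) * n - 15 * n - 14 * n = ((12 * n : ℕ) : ℤ) by push_cast; ring,
    show (41 : ℤ) * n - 15 * n - 12 * n = ((14 * n : ℕ) : ℤ) by push_cast; ring,
    show (41 : ℤ) * n - 15 * n - 11 * n = ((15 * n : ℕ) : ℤ) by push_cast; ring,
    show (41 : ℤ) * n - 14 * n - 11 * n = ((16 * n : ℕ) : ℤ) by push_cast; ring,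
    show (41 : ℤ) * n - 13 * n - 12 * n = ((16 * n : ℕ) : ℤ) by push_cast; ring,
    show (41 : ℤ) * n - 13 * n - 11 * n = ((17 * n : ℕ) : ℤ) by push_cast; ring,
    show (41 : ℤ) * n - 12 * n - 11 * n = ((18 * n : ℕ) : ℤ) by push_cast; ring]
  simp only [Int.toNat_natCast,
    show ((17 : ℤ) * n).toNat = 17 * n by rw [show (17 : ℤ) * n = ((17 * n : ℕ) : ℤ) by push_cast; ring, Int.toNat_natCast],
    show ((14 : ℤ) * n).toNat = 14 * n by rw [show (14 : ℤ) * n = ((14 * n : ℕ) : ℤ) by push_cast; ring, Int.toNat_natCast],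
    show ((13 : ℤ) * n).toNat = 13 * n by rw [show (13 : ℤ) * n = ((13 * n : ℕ) : ℤ) by push_cast; ring, Int.toNat_natCast],
    show ((12 : ℤ) * n).toNat = 12 * n by rw [show (12 : ℤ) * n = ((12 * n : ℕ) : ℤ) by push_cast; ring, Int.toNat_natCast],
    show ((11 : ℤ) * n).toNat = 11 * n by rw [show (11 : ℤ) * n = ((11 * n : ℕ) : ℤ) by push_cast; ring, Int.toNat_natCast],
    show ((25 : ℤ) * n).toNat = 25 * n by rw [show (25 : ℤ) * n = ((25 * n : ℕ) : ℤ) by push_cast; ring, Int.toNat_natCast]]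
  ring

/-! ### 2. The ratio `ρ_{n+1}/ρ_n = N(n)/D(n)` -/

/-- `∏_{i<g} (g·x + i + 1)`: at `x = n` the ratio `(g(n+1))!/(gn)!`. -/
def linVal (g : ℕ) (x : ℚ) : ℚ := ∏ i ∈ range g, ((g : ℚ) * x + ((i : ℚ) + 1))

/-- The same as a polynomial. -/
noncomputable def linFac (g : ℕ) : ℚ[X] := ∏ i ∈ range g, (C (g : ℚ) * X + C ((i : ℚ) + 1))

/-- `linFac g` evaluates to `linVal g`. -/
theorem linFac_eval (g : ℕ) (x : ℚ) : (linFac g).eval x = linVal g x := by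
  simp [linFac, linVal, eval_prod]

/-- `linVal g n > 0`. -/
theorem linVal_pos (g n : ℕ) : 0 < linVal g (n : ℚ) := prod_pos fun i _ => by positivity

/-- `(g(n+1))! = (gn)! · linVal g n`. -/
theorem factorial_mul_succ (g n : ℕ) :
    (((g * (n + 1)).factorial : ℕ) : ℚ) = (((g * n).factorial : ℕ) : ℚ) * linVal g (n : ℚ) := by
  rw [show g * (n + 1) = g * n + g by ring, ← Nat.factorial_mul_ascFactorial, Nat.ascFactorial_eq_prod_range]
  push_cast
  unfold linVal
  congr 1
  exact prod_congr rfl fun i _ => by ring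

/-- `N(x)`: the numerator ratio (fifteen pair factorials). -/
def Nval (x : ℚ) : ℚ :=
  linVal 8 x * linVal 9 x * linVal 10 x * linVal 11 x * linVal 10 x * linVal 11 x * linVal 12 x * linVal 13 x *
    linVal 12 x * linVal 14 x * linVal 15 x * linVal 16 x * linVal 16 x * linVal 17 x * linVal 18 x

/-- `D(x)`: the denominator ratio (five single factorials and `d! = (25n)!`). -/
def Dval (x : ℚ) : ℚ := linVal 17 x * linVal 14 x * linVal 13 x * linVal 12 x * linVal 11 x * linVal 25 x

/-- `N` as a polynomial. -/
noncomputable def Npoly : ℚ[X] :=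
  linFac 8 * linFac 9 * linFac 10 * linFac 11 * linFac 10 * linFac 11 * linFac 12 * linFac 13 *
    linFac 12 * linFac 14 * linFac 15 * linFac 16 * linFac 16 * linFac 17 * linFac 18

/-- `D` as a polynomial. -/
noncomputable def Dpoly : ℚ[X] := linFac 17 * linFac 14 * linFac 13 * linFac 12 * linFac 11 * linFac 25

/-- `Npoly` evaluates to `Nval`. -/
theorem Npoly_eval (x : ℚ) : Npoly.eval x = Nval x := by simp only [Npoly, Nval, eval_mul, linFac_eval]
/-- `Dpoly` evaluates to `Dval`. -/
theorem Dpoly_eval (x : ℚ) : Dpoly.eval x = Dval x := by simp only [Dpoly, Dval, eval_mul, linFac_eval]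

/-- `D(n) > 0`. -/
theorem Dval_pos (n : ℕ) : 0 < Dval (n : ℚ) := by
  unfold Dval
  exact mul_pos (mul_pos (mul_pos (mul_pos (mul_pos (linVal_pos 17 n) (linVal_pos 14 n)) (linVal_pos 13 n))
    (linVal_pos 12 n)) (linVal_pos 11 n)) (linVal_pos 25 n)

/-- `N(n) > 0`. -/
theorem Nval_pos (n : ℕ) : 0 < Nval (n : ℚ) := by
  unfold Nval
  have h := linVal_pos
  exact mul_pos (mul_pos (mul_pos (mul_pos (mul_pos (mul_pos (mul_pos (mul_pos (mul_pos (mul_pos (mul_pos (mul_pos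
    (mul_pos (mul_pos (h 8 n) (h 9 n)) (h 10 n)) (h 11 n)) (h 10 n)) (h 11 n)) (h 12 n)) (h 13 n)) (h 12 n)) (h 14 n))
    (h 15 n)) (h 16 n)) (h 16 n)) (h 17 n)) (h 18 n)

/-- `F(n+1) = F(n) · N(n)`. -/
theorem Fnum_succ (n : ℕ) : Fnum (n + 1) = Fnum n * Nval (n : ℚ) := by
  unfold Fnum Nval
  simp only [factorial_mul_succ]
  ring

/-- `G(n+1) = G(n) · D(n)`. -/
theorem Gden_succ (n : ℕ) : Gden (n + 1) = Gden n * Dval (n : ℚ) := by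
  unfold Gden Dval
  simp only [factorial_mul_succ]
  ring

/-- **`ρ_{n+1}·D(n) = ρ_n·N(n)`.** -/
theorem rho_succ (n : ℕ) : rhoOf (aRec (n + 1)) * Dval (n : ℚ) = rhoOf (aRec n) * Nval (n : ℚ) := by
  rw [rhoOf_aRec_eq, rhoOf_aRec_eq, Fnum_succ, Gden_succ]
  have hG : Gden n ≠ 0 := (Gden_pos n).ne'
  have hD : Dval (n : ℚ) ≠ 0 := (Dval_pos n).ne'
  field_simp

/-! ### 3. The recursion for `(P_n, Q_n)` -/

/-- The coefficients: `C_k = cPoly k · ∏_{j<k} D(X+j) · ∏_{k≤j<3} N(X+j)`. -/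
noncomputable def CPoly : Fin 4 → ℚ[X] :=
  ![cPoly 0 * (Npoly * Npoly.comp (X + C 1) * Npoly.comp (X + C 2)),
    cPoly 1 * (Dpoly * Npoly.comp (X + C 1) * Npoly.comp (X + C 2)),
    cPoly 2 * (Dpoly * Dpoly.comp (X + C 1) * Npoly.comp (X + C 2)),
    cPoly 3 * (Dpoly * Dpoly.comp (X + C 1) * Dpoly.comp (X + C 2))]

/-- A polynomial with a nonzero value is nonzero. -/
theorem poly_ne_zero_of_eval {p : ℚ[X]} {x : ℚ} (h : p.eval x ≠ 0) : p ≠ 0 := fun hp => h (by rw [hp, eval_zero])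

/-- The shifts `D(X + j)` are nonzero polynomials. -/
theorem Dpoly_comp_ne (j : ℕ) : Dpoly.comp (X + C (j : ℚ)) ≠ 0 := by
  refine poly_ne_zero_of_eval (x := 0) ?_
  rw [eval_comp, eval_add, eval_X, eval_C, zero_add, Dpoly_eval]
  exact (Dval_pos j).ne'

/-- The top coefficient `C_3` of the transported recurrence is a nonzero polynomial. -/
theorem CPoly_three_ne : CPoly 3 ≠ 0 := by
  simp only [CPoly, Fin.isValue, Matrix.cons_val]
  have h0 : Dpoly ≠ 0 := poly_ne_zero_of_eval (x := ((0 : ℕ) : ℚ)) (by rw [Dpoly_eval]; exact (Dval_pos 0).ne')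
  have h1 := Dpoly_comp_ne 1
  have h2 := Dpoly_comp_ne 2
  push_cast at h1 h2
  exact mul_ne_zero cPoly_three_ne (mul_ne_zero (mul_ne_zero h0 h1) h2)

/-- The transported relation: if `x_m = ρ_m y_m` for `m ∈ {n, …, n+3}` and `Σ_k c_k(n) y_{n+k} = 0`, then
`Σ_k C_k(n) x_{n+k} = 0`. -/
theorem sum_CPoly_eq_zero (n : ℕ) (x y : ℕ → ℚ) (hxy : ∀ k, k ≤ 3 → x (n + k) = rhoOf (aRec (n + k)) * y (n + k))
    (hy : ∑ k : Fin 4, (cPoly k).eval (n : ℚ) * y (n + k) = 0) :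
    ∑ k : Fin 4, (CPoly k).eval (n : ℚ) * x (n + k) = 0 := by
  have R1 : rhoOf (aRec (n + 1)) * Dval (n : ℚ) = rhoOf (aRec n) * Nval (n : ℚ) := rho_succ n
  have R2 : rhoOf (aRec (n + 2)) * Dval ((n : ℚ) + 1) = rhoOf (aRec (n + 1)) * Nval ((n : ℚ) + 1) := by
    have h := rho_succ (n + 1); push_cast at h; exact h
  have R3 : rhoOf (aRec (n + 3)) * Dval ((n : ℚ) + 2) = rhoOf (aRec (n + 2)) * Nval ((n : ℚ) + 2) := by
    have h := rho_succ (n + 2); push_cast at h; exact h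
  have x0 := hxy 0 (by norm_num)
  have x1 := hxy 1 (by norm_num)
  have x2 := hxy 2 (by norm_num)
  have x3 := hxy 3 (by norm_num)
  simp only [add_zero] at x0
  simp only [Fin.sum_univ_four, Fin.isValue, Fin.val_zero, Fin.val_one, Fin.val_two, add_zero,
    show ((3 : Fin 4) : ℕ) = 3 from rfl] at hy ⊢
  simp only [CPoly, Fin.isValue, Matrix.cons_val_zero, Matrix.cons_val_one, Matrix.cons_val, eval_mul, eval_comp,
    eval_add, eval_X, eval_C, Npoly_eval, Dpoly_eval]
  rw [x0, x1, x2, x3]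
  linear_combination (rhoOf (aRec n) * Nval (n : ℚ) * Nval ((n : ℚ) + 1) * Nval ((n : ℚ) + 2)) * hy +
    ((cPoly 1).eval (n : ℚ) * y (n + 1) * Nval ((n : ℚ) + 1) * Nval ((n : ℚ) + 2)) * R1 +
    ((cPoly 2).eval (n : ℚ) * y (n + 2) * Nval ((n : ℚ) + 2)) * (Dval (n : ℚ) * R2 + Nval ((n : ℚ) + 1) * R1) +
    ((cPoly 3).eval (n : ℚ) * y (n + 3)) *
      (Dval (n : ℚ) * Dval ((n : ℚ) + 1) * R3 + Dval (n : ℚ) * Nval ((n : ℚ) + 2) * R2 +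
        Nval ((n : ℚ) + 1) * Nval ((n : ℚ) + 2) * R1)

/-- **Clause (E) for the literal record pair.**  Brown–Zudilin's `P_n = recordP n` and `Q_n = recordQ n` satisfy one
linear recurrence of order `3` with coefficients in `ℚ[n]` and nonzero top coefficient.  HONEST FRAMING: an algebraic
statement; nothing about `ζ(5)`. -/
theorem aperyType_recordPQ : IsAperyType recordP (fun n => (recordQ n : ℚ)) := by
  refine ⟨3, CPoly, CPoly_three_ne, fun n => ?_, fun n => ?_⟩
  · refine sum_CPoly_eq_zero n recordP pHat (fun k _ => recordP_eq_pHat (n + k)) ?_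
    have h := row_rel 0 n
    simp only [pHat, mul_neg, Finset.sum_neg_distrib, neg_eq_zero]
    exact h
  · rcases Nat.eq_zero_or_pos n with rfl | hn
    · simp [CPoly, cPoly, Fin.sum_univ_four]
    · exact sum_CPoly_eq_zero n (fun m => (recordQ m : ℚ)) qHat (fun k _ => recordQ_eq_qHat (n := n + k) (by omega)) (row_rel 2 n)

end Summit.KontsevichZagierPeriods.Zeta5Search.RecordRay.Generic
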